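import Mathlib
import Literature.Probability.RandomPlanarGeometry.ConformalRectangleProofs
import Literature.Analysis.Complex.BoundaryUniqueness
import HarnessLib

/-!
# Boundary uniqueness on an arc for Jordan domains

Topic `Literature/Probability/RandomPlanarGeometry` (input of the rigidity step of crux
stmt-CriticalPhenomena-0698, `Summits/CriticalPhenomena/CardyFormulaZ2`).

* `JordanDomain.eqOn_zero_of_frontier_arc`: a function holomorphic in a Jordan domain `H`,
  continuous on its closure and vanishing on a relatively open non-empty piece `∂H ∩ V` of the
  boundary vanishes identically (pull back along the Carathéodory extension of a Riemann map
  `𝔻 → H`, `JordanDomain.exists_continuousOn_extension_holds`, and apply the disc case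
  `Complex.eqOn_zero_of_diffContOnCl_ball_of_eqOn_arc`; Rudin, *Real and Complex Analysis*,
  Thm. 17.18 for the general boundary uniqueness theorem).
* `continuousOn_piecewise_of_tendsto`: gluing boundary limits into a continuous extension.
* `eqOn_id_of_eqOn_open`: the identity theorem in the form used (a holomorphic map equal to the
  identity on a non-empty open subset of a connected open set is the identity).

## References

* W. Rudin, *Real and Complex Analysis*, 3rd ed. (1987), Thm. 17.18.
* Ch. Pommerenke, *Boundary Behaviour of Conformal Maps* (1992), Thm. 2.6.
-/

noncomputable section

open Set Filter Topology Complex Metric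

namespace Literature.Probability.RandomPlanarGeometry

/-- **Boundary uniqueness on an arc, Jordan-domain form.** If `F` is holomorphic in the Jordan
domain `H`, continuous on `closure H`, and vanishes on `frontier H ∩ V` for an open set `V`
meeting the frontier, then `F = 0` on `H`. [cite: Rudin1987, Thm. 17.18] -/
theorem JordanDomain.eqOn_zero_of_frontier_arc (H : JordanDomain) {F : ℂ → ℂ}
    (hFd : DifferentiableOn ℂ F H.carrier) (hFc : ContinuousOn F (closure H.carrier))
    {V : Set ℂ} (hV : IsOpen V) (hne : (frontier H.carrier ∩ V).Nonempty)
    (h0 : ∀ z ∈ frontier H.carrier ∩ V, F z = 0) : EqOn F 0 H.carrier := by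
  have hsc : IsSimplyConnected H.carrier :=
    Complex.isSimplyConnected_of_isPreconnected_frontier H.isOpen H.isConnected H.isBounded
      (H.range_boundary ▸ isPreconnected_range H.continuous_boundary)
  obtain ⟨ψ⟩ := (exists_conformalEquiv_ball_holds (U := H.carrier)) H.isOpen hsc H.carrier_ne_univ
  obtain ⟨Ψ, hΨc, hΨeq, hbij, hsph⟩ :=
    JordanDomain.exists_continuousOn_extension_holds H ψ.symm
  -- the pulled-back function on the closed disc
  have hd : DiffContOnCl ℂ (F ∘ Ψ) (ball 0 1) := by
    refine ⟨?_, ?_⟩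
    · refine (hFd.comp ψ.symm.differentiableOn ψ.symm.mapsTo).congr fun ζ hζ ↦ ?_
      rw [Function.comp_apply, hΨeq hζ]
      rfl
    · rw [closure_ball (0 : ℂ) one_ne_zero]
      exact hFc.comp hΨc hbij.mapsTo
  -- the open arc of the circle mapped into `V`
  obtain ⟨U, hU, hUeq⟩ := (_root_.continuousOn_iff'.1 hΨc) V hV
  have hUV : ∀ ζ ∈ sphere (0 : ℂ) 1 ∩ U, Ψ ζ ∈ V := by
    rintro ζ ⟨hζs, hζU⟩
    have : ζ ∈ Ψ ⁻¹' V ∩ closedBall 0 1 := by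
      rw [hUeq]; exact ⟨hζU, sphere_subset_closedBall hζs⟩
    exact this.1
  have hne' : (sphere (0 : ℂ) 1 ∩ U).Nonempty := by
    obtain ⟨q, hqf, hqV⟩ := hne
    obtain ⟨ζ, hζs, hζq⟩ := hsph.surjOn hqf
    have : ζ ∈ Ψ ⁻¹' V ∩ closedBall 0 1 :=
      ⟨by rw [mem_preimage, hζq]; exact hqV, sphere_subset_closedBall hζs⟩
    rw [hUeq] at this
    exact ⟨ζ, hζs, this.1⟩
  have hzero : ∀ ζ ∈ sphere (0 : ℂ) 1 ∩ U, (F ∘ Ψ) ζ = 0 := fun ζ hζ ↦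
    h0 _ ⟨hsph.mapsTo hζ.1, hUV ζ hζ⟩
  have key := Complex.eqOn_zero_of_diffContOnCl_ball_of_eqOn_arc hd hU hne' hzero
  intro z hz
  have h1 : Ψ (ψ z) = z := by
    rw [hΨeq (ψ.mapsTo hz)]
    exact ψ.symm_apply_apply hz
  have h2 := key (ball_subset_closedBall (ψ.mapsTo hz))
  rw [Function.comp_apply, h1] at h2
  exact h2

/-- **Gluing boundary limits.** If `k` is continuous on the open set `H` and tends to `q` at every
point `q` of a set `S` disjoint from `H`, then the map equal to `k` on `H` and to the identity
elsewhere is continuous on `H ∪ S`. [folklore] -/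
theorem continuousOn_piecewise_of_tendsto {k : ℂ → ℂ} {H S : Set ℂ} [DecidablePred (· ∈ H)]
    (hH : IsOpen H) (hk : ContinuousOn k H) (hdisj : Disjoint S H)
    (hlim : ∀ q ∈ S, Tendsto k (𝓝[H] q) (𝓝 q)) :
    ContinuousOn (H.piecewise k id) (H ∪ S) := by
  rintro z (hzH | hzS)
  · have h1 : ContinuousAt k z := hk.continuousAt (hH.mem_nhds hzH)
    have h2 : H.piecewise k id =ᶠ[𝓝 z] k := by
      filter_upwards [hH.mem_nhds hzH] with x hx
      exact piecewise_eq_of_mem _ _ _ hx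
    have h3 : ContinuousAt (H.piecewise k id) z := by
      refine (h1.congr h2.symm : _)
    exact h3.continuousWithinAt
  · have hzH : z ∉ H := fun h ↦ hdisj.le_bot ⟨hzS, h⟩
    change Tendsto (H.piecewise k id) (𝓝[H ∪ S] z) (𝓝 (H.piecewise k id z))
    rw [piecewise_eq_of_notMem _ _ _ hzH, id, nhdsWithin_union]
    refine Tendsto.sup ?_ ?_
    · refine (hlim z hzS).congr' ?_
      filter_upwards [self_mem_nhdsWithin] with x hx
      exact (piecewise_eq_of_mem _ _ _ hx).symm
    · have h1 : Tendsto id (𝓝[S] z) (𝓝 z) := tendsto_id.mono_left nhdsWithin_le_nhds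
      refine h1.congr' ?_
      filter_upwards [self_mem_nhdsWithin] with x hx
      exact (piecewise_eq_of_notMem _ _ _ (fun h ↦ hdisj.le_bot ⟨hx, h⟩)).symm

/-- **Identity theorem, as used.** A holomorphic map on a connected open set `U` which is the
identity on a non-empty open subset `W ⊆ U` is the identity on `U`. [folklore] -/
theorem eqOn_id_of_eqOn_open {k : ℂ → ℂ} {U W : Set ℂ} (hU : IsOpen U) (hUc : IsConnected U)
    (hk : DifferentiableOn ℂ k U) (hW : IsOpen W) (hWU : W ⊆ U) (hWne : W.Nonempty)
    (h : EqOn k id W) : EqOn k id U := by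
  obtain ⟨z₀, hz₀⟩ := hWne
  have hka : AnalyticOnNhd ℂ k U := hk.analyticOnNhd hU
  have hia : AnalyticOnNhd ℂ (id : ℂ → ℂ) U := analyticOnNhd_id
  refine hka.eqOn_of_preconnected_of_eventuallyEq hia hUc.isPreconnected (hWU hz₀) ?_
  filter_upwards [hW.mem_nhds hz₀] with z hz
  exact h hz

end Literature.Probability.RandomPlanarGeometry
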